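import Mathlib.Analysis.Calculus.FDeriv.RestrictScalars
import Mathlib.Analysis.Calculus.Deriv.Comp
import Mathlib.Analysis.Calculus.Deriv.Mul
import Mathlib.Analysis.Calculus.Deriv.Add
import Mathlib.Analysis.Complex.Basic
import Mathlib.LinearAlgebra.Matrix.Trace
import Mathlib.LinearAlgebra.Matrix.ConjTranspose
import Mathlib.LinearAlgebra.Complex.Module
import HarnessLib

/-!
# K0⁷ STUB 1 (`stub_prop8StepCoP13`), sub-target S4b «the (δ∕δA′)V pieces at objects» — **THE τ-BILINEAR ∕ FROBENIUS DICTIONARY OF INSTANCE (S) AND THE DERIVATIVE OF `V`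
# ALONG A REAL LINE**: the two quadratic terms of this seat's Socket functional `V = ½B(D, η^dM♭D) − B(Qlin♭A, η^dM♭D) + V₀` (C″ `…SectFWSlotAtRecordFlatScaled`, `B = Σ_t τ`,
# `τ = N⁻¹tr`, `M♭ = λ⁻¹Mλ⁻¹`, `Qlin♭ = λQ`) ARE the two middle terms of dag-n07-w1's (157) `(N·c²)⁻¹(½⟨Dd, M Dd⟩_F − ⟨Q X, M Dd⟩_F)` (p627407, Frobenius pairing
# `⟨X, Y⟩_F = Σ Re tr(XᴴY)`, 𝔰𝔲(N) letters `X = iη•A`, `Dd = iη•λ⁻¹•D`) at `c = η⁻¹`, `d = 4` — EXACTLY, no constant left over; and (v) of dag-n07-w1's criticality spine: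
# `HasFDerivAt V φ A ⇒ HasDerivAt (t ↦ Re V(A + t•δ)) (Re φδ) 0`

Cell `pub-ymgap`, width seat `pub-ymgap-k0-s1-w2` g5 (CLAIM-5″; asked by dag-n07-w1 g6 `…N07SocketOfChartedCriticality` «(v) is k0-s1-w2's `HasFDerivAt V (BE (W A′)) A′` composed
with the line and the τ→Frobenius conversion» and by dag-k0-s1-w1 g7 `…K0Stub1FlatChartCriticalityTransfer` «the junction you can write against it»).
`--kind proof --supports stmt-QuantumFields-20541 --as helper`; count-neutral; def-free; Mathlib-only (generic finite index types, `M_N(ℂ)`).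
[15] = [Balaban1985Variational].

WHY.  dag-k0-s1-w4 g2 LOCATED (bus 2026-08-28 11:50Z; this seat's RULING: CONCUR) that print's (80) `V(A′) = ½⟨D, MD⟩ − ⟨QA′, MD⟩ + V₀(A′ − HD)` in the Socket's ♭ letters
`(Qlin♭, H♭, Dsel♭)` carries the SCALED multiplier `M♭ = λ⁻¹(η^dM)λ⁻¹`, `λ_t = L^{j(t)}η` — instance (S).  dag-n07-w1's (157) at NODE 00 (p627407
`wilsonAction4_expChart_one_chart_eq157`) writes the same two terms in S1's REAL currency: 𝔰𝔲(N)-valued `X = iηA′`, datum `Dd` with `W = H_V Dd` (`= H♭D♭` forces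
`Dd = iη•λ⁻¹•D♭`), Frobenius pairing and the Riesz factor `(N·c²)⁻¹`.  The (127)∕(128) junction on the ♭ road (dag-n07-w1's spine ∘ dag-k0-s1-w1's criticality transfer ∘ this
seat's W-slot C″∕D″) needs the two currencies IDENTIFIED and the derivative of `V` along a real kernel line expressed through `W`.  THIS FILE is that dictionary: pure
finite-sum algebra over real kernels (`M`, `Q`) and real positive scalings (`λ`), for HERMITIAN `A′`, `D` (print's convention `U = e^{iηA}`; the reality of the ♭ chart is
dag-k0-s1-w4's `…K0Stub1FlatChartStar`), plus one line of calculus.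

WHAT IS PROVED (sorry-free; no definition; axioms standard).
* §1 `conjTranspose_I_real_smul` — `((iηr)•X)ᴴ = (−iηr)•X` for Hermitian `X` · ★★ `frobenius_scaled_quadratic_eq` — for a real kernel `m`, real nonvanishing scaling `λ`,
  maps `MV`, `Mf` with the kernels `m(t,s)` and `λ_t⁻¹m(t,s)λ_s⁻¹`, and a Hermitian field `D`:
  `Σ_t Re tr(((iηλ_t⁻¹)•D_t)ᴴ · (MV (iη•λ⁻¹•D))_t) = η²·Re Σ_t tr(D_t · (Mf D)_t)`;
  ★★ `frobenius_scaled_cross_eq` — plus a real kernel `q` with `QV A t = Σ_b q(t,b)•A_b`, `Qlin A t = Σ_b (λ_t q(t,b))•A_b` and a Hermitian `A`: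
  `Σ_t Re tr(((QV (iη•A))_t)ᴴ · (MV (iη•λ⁻¹•D))_t) = η²·Re Σ_t tr((Qlin A)_t · (Mf D)_t)`.
* §1 ★★★ `eq157_middle_terms_flatScaled` — with the `N⁻¹`-normalised trace pairing `B X Y = Σ_t τ(X_t Y_t)`, `N·τ = tr`, and `c = η⁻¹`:
  `(N·c²)⁻¹·(½·Σ_t Re tr(Dd_tᴴ(MV Dd)_t) − Σ_t Re tr((QV X)_tᴴ(MV Dd)_t)) = Re(½·B D ((η⁴:ℂ)•Mf D) − B (Qlin A) ((η⁴:ℂ)•Mf D))` — (157)'s middle block IS `Re` of the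
  Socket's two quadratic terms at instance (S), `d = 4`, k-UNIFORMLY (no `λ` survives).
* §2 ★★ `hasDerivAt_re_comp_realLine` — `HasFDerivAt V φ A` (over `ℂ`, `V : E → ℂ`) ⇒ `HasDerivAt (fun t : ℝ => (V (A + (t:ℂ)•δ)).re) (φ δ).re 0`: input (v) of
  dag-n07-w1's `inner_hessOpAt_add_eq_zero_of_isCritOnFibre` from this seat's (157) `HasFDerivAt … (BE (W A′)) A′` (C″∕D″), `v = Re BE(W A′, δ)`.
HONEST SCOPE.  Algebra and one chain rule; NO estimate; the V₀-term dictionary (`B11Eq26ActionExpansion.V0` ↔ S1's `Σ_q Re rem3`) and the `TangentBondSU` packaging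
(`X = iη•A`, `expChart 1 X = e^{iηA}`, `AgreeOn 𝔹` vs `LamBond`) stay with the assembler of the spine; nothing of [15] Sects. D–F asserted; `stub_prop8StepCoP13` ∕ K0⁷ NOT
closed; N07 NOT discharged; no summit statement is proved by this seat; counts unmoved (28∕28 · 5∕27); one finite 𝕋⁴ programme at fixed ε — R4 closes the conditional
finite-𝕋⁴ rung `BalabanLadder.UV` only, never the summit; the YM mass gap (Clay) is NOT proved by any of this; nothing continuum ∕ ℝ⁴ ∕ OS.  No `sorry`, no `def`, no
`instance`, no `notation`.

References: [15] (26)–(27) p.282, (45)–(47) p.285, (80) p.290, (88) p.291, (127)–(128) p.297, (157) p.302; [Balaban1985BackgroundPropagators] (3.10)–(3.12) p.392.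
-/

set_option autoImplicit false

noncomputable section

open scoped BigOperators ComplexConjugate Matrix

namespace Summit.QuantumFields.YangMills.Theorems.K0Stub1FlatScaledFrobeniusDictionary

/-! ## §1  The τ-bilinear ∕ Frobenius dictionary of the scaled letters -/

section Trace

variable {κ ι : Type*} [Fintype κ] [Fintype ι] {N : ℕ}

/-- `((iηr)•X)ᴴ = (−(iηr))•X` for a Hermitian matrix `X` and real `η, r`. [folklore] -/
theorem conjTranspose_I_real_smul (η r : ℝ) {X : Matrix (Fin N) (Fin N) ℂ} (hX : Xᴴ = X) :
    ((Complex.I * (η : ℂ) * (r : ℂ)) • X)ᴴ = (-(Complex.I * (η : ℂ) * (r : ℂ))) • X := by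
  rw [Matrix.conjTranspose_smul, hX]
  congr 1
  simp [Complex.conj_ofReal, Complex.conj_I, mul_comm, mul_left_comm]

/-- ★★ **THE QUADRATIC TERM**: for a real kernel `m` read by `MV X t = Σ_s m(t,s)•X_s`, the scaled kernel `Mf X t = Σ_s (λ_t⁻¹m(t,s)λ_s⁻¹)•X_s`, and a HERMITIAN block field `D`,
the 𝔰𝔲(N) datum `Dd = iη•λ⁻¹•D` satisfies `Σ_t Re tr(Dd_tᴴ·(MV Dd)_t) = η²·Re Σ_t tr(D_t·(Mf D)_t)` — the Frobenius square `⟨Dd, M Dd⟩_F` of (157) is `η²` times the bilinear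
trace square of the ♭ letters. [cite: Balaban1985Variational, (80) p.290, (157) p.302] -/
theorem frobenius_scaled_quadratic_eq (η : ℝ) (lam : κ → ℝ) (m : κ → κ → ℝ)
    (MV Mf : (κ → Matrix (Fin N) (Fin N) ℂ) → (κ → Matrix (Fin N) (Fin N) ℂ))
    (hMV : ∀ (X : κ → Matrix (Fin N) (Fin N) ℂ) (t : κ), MV X t = ∑ s, ((m t s : ℝ) : ℂ) • X s)
    (hMf : ∀ (X : κ → Matrix (Fin N) (Fin N) ℂ) (t : κ), Mf X t = ∑ s, (((lam t)⁻¹ * m t s * (lam s)⁻¹ : ℝ) : ℂ) • X s)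
    (D : κ → Matrix (Fin N) (Fin N) ℂ) (hD : ∀ t, (D t)ᴴ = D t) :
    ∑ t, (((Complex.I * (η : ℂ) * ((lam t)⁻¹ : ℝ)) • D t)ᴴ *
        MV (fun s => (Complex.I * (η : ℂ) * ((lam s)⁻¹ : ℝ)) • D s) t).trace.re
      = η ^ 2 * (∑ t, (D t * Mf D t).trace).re := by
  -- termwise: `((iηλ_t⁻¹)•D_t)ᴴ · Σ_s m•((iηλ_s⁻¹)•D_s) = η² • (D_t · Σ_s (λ_t⁻¹ m λ_s⁻¹)•D_s)`
  have hterm : ∀ t, ((Complex.I * (η : ℂ) * ((lam t)⁻¹ : ℝ)) • D t)ᴴ * MV (fun s => (Complex.I * (η : ℂ) * ((lam s)⁻¹ : ℝ)) • D s) t =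
      ((η : ℂ) ^ 2) • (D t * Mf D t) := by
    intro t
    rw [conjTranspose_I_real_smul η _ (hD t), hMV, hMf, Finset.mul_sum, Finset.mul_sum, Finset.smul_sum]
    refine Finset.sum_congr rfl fun s _ => ?_
    rw [smul_smul, Matrix.smul_mul, Matrix.mul_smul, smul_smul, Matrix.mul_smul, smul_smul]
    congr 1
    push_cast
    have hI : Complex.I * Complex.I = -1 := Complex.I_mul_I
    linear_combination (-((η : ℂ) ^ 2 * ((lam t)⁻¹ : ℂ) * (m t s : ℂ) * ((lam s)⁻¹ : ℂ))) * hI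
  simp_rw [hterm, Matrix.trace_smul, smul_eq_mul, ← Complex.ofReal_pow, Complex.re_ofReal_mul]
  rw [← Finset.mul_sum, Complex.re_sum]

omit [Fintype κ] in
/-- A kernel-read map commutes with scalars: `QV (c•A) t = c • QV A t`. [folklore] -/
theorem kernelMap_smul (q : κ → ι → ℝ) (QV : (ι → Matrix (Fin N) (Fin N) ℂ) → (κ → Matrix (Fin N) (Fin N) ℂ))
    (hQV : ∀ (A : ι → Matrix (Fin N) (Fin N) ℂ) (t : κ), QV A t = ∑ b, ((q t b : ℝ) : ℂ) • A b)
    (c : ℂ) (A : ι → Matrix (Fin N) (Fin N) ℂ) (t : κ) : QV (fun b => c • A b) t = c • QV A t := by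
  rw [hQV, hQV, Finset.smul_sum]
  exact Finset.sum_congr rfl fun b _ => by rw [smul_comm]

omit [Fintype κ] in
/-- A real-kernel map preserves Hermitian fields: `(QV A t)ᴴ = QV A t` when every `A b` is Hermitian. [folklore] -/
theorem kernelMap_herm (q : κ → ι → ℝ) (QV : (ι → Matrix (Fin N) (Fin N) ℂ) → (κ → Matrix (Fin N) (Fin N) ℂ))
    (hQV : ∀ (A : ι → Matrix (Fin N) (Fin N) ℂ) (t : κ), QV A t = ∑ b, ((q t b : ℝ) : ℂ) • A b)
    (A : ι → Matrix (Fin N) (Fin N) ℂ) (hA : ∀ b, (A b)ᴴ = A b) (t : κ) : (QV A t)ᴴ = QV A t := by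
  rw [hQV, Matrix.conjTranspose_sum]
  exact Finset.sum_congr rfl fun b _ => by rw [Matrix.conjTranspose_smul, hA, Complex.star_def, Complex.conj_ofReal]

/-- ★★ **THE CROSS TERM**: with, in addition, a real kernel `q` read by `QV A t = Σ_b q(t,b)•A_b` and its `λ`-scaled version `Qlin A t = Σ_b (λ_t·q(t,b))•A_b` (the tree's
`Qlin♭ = (Lʲη)•Q_V`, p621264), a HERMITIAN fine field `A` and the 𝔰𝔲(N) letter `X = iη•A`:
`Σ_t Re tr(((QV X)_t)ᴴ·(MV Dd)_t) = η²·Re Σ_t tr((Qlin A)_t·(Mf D)_t)` (`λ_t ≠ 0`). [cite: Balaban1985Variational, (80) p.290, (88) p.291, (157) p.302] -/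
theorem frobenius_scaled_cross_eq (η : ℝ) (lam : κ → ℝ) (hlam : ∀ t, lam t ≠ 0) (m : κ → κ → ℝ) (q : κ → ι → ℝ)
    (MV Mf : (κ → Matrix (Fin N) (Fin N) ℂ) → (κ → Matrix (Fin N) (Fin N) ℂ))
    (hMV : ∀ (X : κ → Matrix (Fin N) (Fin N) ℂ) (t : κ), MV X t = ∑ s, ((m t s : ℝ) : ℂ) • X s)
    (hMf : ∀ (X : κ → Matrix (Fin N) (Fin N) ℂ) (t : κ), Mf X t = ∑ s, (((lam t)⁻¹ * m t s * (lam s)⁻¹ : ℝ) : ℂ) • X s)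
    (QV Qlin : (ι → Matrix (Fin N) (Fin N) ℂ) → (κ → Matrix (Fin N) (Fin N) ℂ))
    (hQV : ∀ (A : ι → Matrix (Fin N) (Fin N) ℂ) (t : κ), QV A t = ∑ b, ((q t b : ℝ) : ℂ) • A b)
    (hQlin : ∀ (A : ι → Matrix (Fin N) (Fin N) ℂ) (t : κ), Qlin A t = ∑ b, ((lam t * q t b : ℝ) : ℂ) • A b)
    (A : ι → Matrix (Fin N) (Fin N) ℂ) (hA : ∀ b, (A b)ᴴ = A b) (D : κ → Matrix (Fin N) (Fin N) ℂ) :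
    ∑ t, ((QV (fun b => (Complex.I * (η : ℂ)) • A b) t)ᴴ *
        MV (fun s => (Complex.I * (η : ℂ) * ((lam s)⁻¹ : ℝ)) • D s) t).trace.re
      = η ^ 2 * (∑ t, (Qlin A t * Mf D t).trace).re := by
  -- `Qlin A t = λ_t • QV A t`
  have hQlin' : ∀ t, Qlin A t = ((lam t : ℝ) : ℂ) • QV A t := by
    intro t
    rw [hQlin, hQV, Finset.smul_sum]
    exact Finset.sum_congr rfl fun b _ => by rw [smul_smul, Complex.ofReal_mul]
  -- `Mf D t = λ_t⁻¹ • Σ_s (m λ_s⁻¹) • D_s` and `MV Dd t = (iη) • Σ_s (m λ_s⁻¹) • D_s`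
  have hMf' : ∀ t, Mf D t = (((lam t)⁻¹ : ℝ) : ℂ) • ∑ s, ((m t s * (lam s)⁻¹ : ℝ) : ℂ) • D s := by
    intro t
    rw [hMf, Finset.smul_sum]
    exact Finset.sum_congr rfl fun s _ => by rw [smul_smul, ← Complex.ofReal_mul, mul_assoc]
  have hMV' : ∀ t, MV (fun s => (Complex.I * (η : ℂ) * ((lam s)⁻¹ : ℝ)) • D s) t =
      (Complex.I * (η : ℂ)) • ∑ s, ((m t s * (lam s)⁻¹ : ℝ) : ℂ) • D s := by
    intro t
    rw [hMV, Finset.smul_sum]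
    exact Finset.sum_congr rfl fun s _ => by
      rw [smul_smul, smul_smul]; congr 1; push_cast; ring
  have hterm : ∀ t, (QV (fun b => (Complex.I * (η : ℂ)) • A b) t)ᴴ * MV (fun s => (Complex.I * (η : ℂ) * ((lam s)⁻¹ : ℝ)) • D s) t =
      ((η : ℂ) ^ 2) • (Qlin A t * Mf D t) := by
    intro t
    rw [kernelMap_smul q QV hQV, Matrix.conjTranspose_smul, kernelMap_herm q QV hQV A hA, hMV', hQlin', hMf',
      Matrix.smul_mul, Matrix.mul_smul, smul_smul, Matrix.smul_mul, Matrix.mul_smul, smul_smul, smul_smul]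
    congr 1
    have hl : ((lam t : ℝ) : ℂ) * (((lam t)⁻¹ : ℝ) : ℂ) = 1 := by
      rw [← Complex.ofReal_mul, mul_inv_cancel₀ (hlam t), Complex.ofReal_one]
    have hI : Complex.I * Complex.I = -1 := Complex.I_mul_I
    have hstar : star (Complex.I * (η : ℂ)) = -(Complex.I * (η : ℂ)) := by
      rw [star_mul', Complex.star_def, Complex.conj_I, Complex.conj_ofReal]; ring
    rw [hstar]
    linear_combination (-((η : ℂ) ^ 2)) * hI - ((η : ℂ) ^ 2) * hl
  simp_rw [hterm, Matrix.trace_smul, smul_eq_mul, ← Complex.ofReal_pow, Complex.re_ofReal_mul]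
  rw [← Finset.mul_sum, Complex.re_sum]

/-- ★★★ **(157)'s MIDDLE BLOCK IS `Re` OF THE SOCKET's TWO QUADRATIC TERMS AT INSTANCE (S), `d = 4`, `c = η⁻¹`.**  With the `N⁻¹`-normalised trace pairing
`B X Y = Σ_t τ(X_t·Y_t)`, `N·τ = tr` (`τ = ntr`), the letters of the two previous theorems and `η ≠ 0`, `N ≠ 0`:
`(N·(η⁻¹)²)⁻¹·(½·Σ_t Re tr(Dd_tᴴ(MV Dd)_t) − Σ_t Re tr((QV X)_tᴴ(MV Dd)_t)) = Re(½·B D (η⁴•Mf D) − B (Qlin A) (η⁴•Mf D))` — the Frobenius∕Riesz currency of dag-n07-w1's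
`wilsonAction4_expChart_one_chart_eq157` (p627407, `Dd = iη•λ⁻¹•D`, `X = iη•A`) against this seat's Socket functional at `(Qlin♭, M♭ = λ⁻¹Mλ⁻¹)` with the multiplier
`η^d•M♭`, k-UNIFORM (no `λ` survives). [cite: Balaban1985Variational, (27) p.282, (80) p.290, (88) p.291, (157) p.302; Balaban1985BackgroundPropagators, (3.10)-(3.12) p.392] -/
theorem eq157_middle_terms_flatScaled {η : ℝ} (hη : η ≠ 0) (hN : N ≠ 0) (lam : κ → ℝ) (hlam : ∀ t, lam t ≠ 0) (m : κ → κ → ℝ) (q : κ → ι → ℝ)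
    (MV Mf : (κ → Matrix (Fin N) (Fin N) ℂ) → (κ → Matrix (Fin N) (Fin N) ℂ))
    (hMV : ∀ (X : κ → Matrix (Fin N) (Fin N) ℂ) (t : κ), MV X t = ∑ s, ((m t s : ℝ) : ℂ) • X s)
    (hMf : ∀ (X : κ → Matrix (Fin N) (Fin N) ℂ) (t : κ), Mf X t = ∑ s, (((lam t)⁻¹ * m t s * (lam s)⁻¹ : ℝ) : ℂ) • X s)
    (QV Qlin : (ι → Matrix (Fin N) (Fin N) ℂ) → (κ → Matrix (Fin N) (Fin N) ℂ))
    (hQV : ∀ (A : ι → Matrix (Fin N) (Fin N) ℂ) (t : κ), QV A t = ∑ b, ((q t b : ℝ) : ℂ) • A b)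
    (hQlin : ∀ (A : ι → Matrix (Fin N) (Fin N) ℂ) (t : κ), Qlin A t = ∑ b, ((lam t * q t b : ℝ) : ℂ) • A b)
    (τ : Matrix (Fin N) (Fin N) ℂ →ₗ[ℂ] ℂ) (hτ : ∀ X, (N : ℂ) * τ X = X.trace)
    (B : (κ → Matrix (Fin N) (Fin N) ℂ) → (κ → Matrix (Fin N) (Fin N) ℂ) → ℂ) (hB : ∀ X Y, B X Y = ∑ t, τ (X t * Y t))
    (A : ι → Matrix (Fin N) (Fin N) ℂ) (hA : ∀ b, (A b)ᴴ = A b) (D : κ → Matrix (Fin N) (Fin N) ℂ) (hD : ∀ t, (D t)ᴴ = D t) :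
    ((N : ℝ) * (η⁻¹) ^ 2)⁻¹ *
        (2⁻¹ * ∑ t, (((Complex.I * (η : ℂ) * ((lam t)⁻¹ : ℝ)) • D t)ᴴ *
            MV (fun s => (Complex.I * (η : ℂ) * ((lam s)⁻¹ : ℝ)) • D s) t).trace.re
          - ∑ t, ((QV (fun b => (Complex.I * (η : ℂ)) • A b) t)ᴴ *
            MV (fun s => (Complex.I * (η : ℂ) * ((lam s)⁻¹ : ℝ)) • D s) t).trace.re)
      = (2⁻¹ * B D (((η : ℂ) ^ 4) • Mf D) - B (Qlin A) (((η : ℂ) ^ 4) • Mf D)).re := by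
  rw [frobenius_scaled_quadratic_eq η lam m MV Mf hMV hMf D hD,
    frobenius_scaled_cross_eq η lam hlam m q MV Mf hMV hMf QV Qlin hQV hQlin A hA D, hB, hB]
  -- `τ(X·(η⁴•Y)) = η⁴·N⁻¹·tr(X·Y)`
  have hNc : (N : ℂ) ≠ 0 := Nat.cast_ne_zero.mpr hN
  have hτ' : ∀ X : Matrix (Fin N) (Fin N) ℂ, τ X = (N : ℂ)⁻¹ * X.trace := fun X => by
    rw [← hτ X, ← mul_assoc, inv_mul_cancel₀ hNc, one_mul]
  have hsum : ∀ (X Y : κ → Matrix (Fin N) (Fin N) ℂ), ∑ t, τ (X t * (((η : ℂ) ^ 4) • Y) t) = (N : ℂ)⁻¹ * (η : ℂ) ^ 4 * ∑ t, (X t * Y t).trace := by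
    intro X Y
    rw [Finset.mul_sum]
    refine Finset.sum_congr rfl fun t _ => ?_
    rw [Pi.smul_apply, Matrix.mul_smul, hτ', Matrix.trace_smul, smul_eq_mul]; ring
  rw [hsum, hsum]
  -- real parts
  have hre : ∀ z : ℂ, ((N : ℂ)⁻¹ * (η : ℂ) ^ 4 * z).re = (N : ℝ)⁻¹ * η ^ 4 * z.re := by
    intro z
    have : (N : ℂ)⁻¹ * (η : ℂ) ^ 4 = (((N : ℝ)⁻¹ * η ^ 4 : ℝ) : ℂ) := by push_cast; ring
    rw [this, Complex.re_ofReal_mul]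
  have h2 : ∀ z : ℂ, ((2 : ℂ)⁻¹ * z).re = 2⁻¹ * z.re := fun z => by
    have : (2 : ℂ)⁻¹ = ((2⁻¹ : ℝ) : ℂ) := by push_cast; ring
    rw [this, Complex.re_ofReal_mul]
  rw [Complex.sub_re, h2, hre, hre]
  have hN0 : (N : ℝ) ≠ 0 := Nat.cast_ne_zero.mpr hN
  field_simp

end Trace

/-! ## §2  (v) of the criticality spine: the derivative of `V` along a real line from its complex Fréchet derivative -/

section Line

variable {E : Type*} [NormedAddCommGroup E] [NormedSpace ℂ E]

/-- ★★ **THE DERIVATIVE OF `Re V` ALONG A REAL LINE**: `HasFDerivAt V φ A` over `ℂ` (`V : E → ℂ`, e.g. this seat's (157) `HasFDerivAt V (BE (W A′)) A′`) gives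
`HasDerivAt (fun t : ℝ => (V (A + (t:ℂ)•δ)).re) (φ δ).re 0` — input (v) of dag-n07-w1's `inner_hessOpAt_add_eq_zero_of_isCritOnFibre` with `v = Re BE(W A′, δ)` (restriction of
scalars + chain rule + `Complex.reCLM`). [cite: Balaban1985Variational, (127)-(128) p.297, (157) p.302] -/
theorem hasDerivAt_re_comp_realLine (V : E → ℂ) {φ : E →L[ℂ] ℂ} {A : E} (hV : HasFDerivAt V φ A) (δ : E) :
    HasDerivAt (fun t : ℝ => (V (A + (t : ℂ) • δ)).re) (φ δ).re 0 := by
  -- the real line `t ↦ A + t•δ` and its derivative `δ`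
  have hline : HasDerivAt (fun t : ℝ => A + (t : ℂ) • δ) δ 0 := by
    have h : HasDerivAt (fun t : ℝ => A + t • δ) ((1 : ℝ) • δ) 0 :=
      HasDerivAt.const_add A (HasDerivAt.smul_const (hasDerivAt_id (0 : ℝ)) δ)
    rw [one_smul] at h
    refine h.congr_of_eventuallyEq (Filter.Eventually.of_forall fun t => ?_)
    show A + (t : ℂ) • δ = A + t • δ
    rw [Complex.coe_smul]
  have hA0 : A + ((0 : ℝ) : ℂ) • δ = A := by rw [Complex.ofReal_zero, zero_smul, add_zero]
  have hVℝ : HasFDerivAt V (φ.restrictScalars ℝ) (A + ((0 : ℝ) : ℂ) • δ) := by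
    rw [hA0]; exact HasFDerivAt.restrictScalars ℝ hV
  have hcomp : HasDerivAt (fun t : ℝ => V (A + (t : ℂ) • δ)) ((φ.restrictScalars ℝ) δ) 0 :=
    HasFDerivAt.comp_hasDerivAt (0 : ℝ) hVℝ hline
  -- real part: `re` is ℝ-linear
  have hre : HasDerivAt (fun t : ℝ => Complex.reCLM (V (A + (t : ℂ) • δ))) (Complex.reCLM ((φ.restrictScalars ℝ) δ)) 0 :=
    HasFDerivAt.comp_hasDerivAt (0 : ℝ) (ContinuousLinearMap.hasFDerivAt Complex.reCLM) hcomp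
  exact hre

end Line

end Summit.QuantumFields.YangMills.Theorems.K0Stub1FlatScaledFrobeniusDictionary

end
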